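import Summits.ValiantsHypothesis.ValiantsHypothesis.Theorems.LacunarySymmetroidMatrixDescartesCensusDoorA34RankTwoNet

/-!
# `MatrixDescartes` census — DOOR A at `(2,6)`: the RANK-TWO NET stratum of `2 × 2` pencils, ALL supports

HONEST FRAMING.  Object-search cell `pub-symmetroid`, door-A seat `val-sym-door-p3` (g23); a PARTIAL-RANGE row `--supports` the
route item `Theses.LacunarySymmetroid.DoorA26` (stmt-ValiantsHypothesis-19979, `DoorA26 = PosRootLawAt 2 6 19`), which is OPEN and
asserted nowhere in this file.  Companion of `…CensusDoorA34RankTwoNet` (the `3 × 3` count `≤ 3·(K − 1)`) one size down: real `2 × 2`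
letters lying in the span of two matrices `T₀, T₁` (for `2 × 2` SYMMETRIC letters this is ONE linear condition on the six letters of a
`(2,6)` pencil, since `Sym₂(ℝ)` is three-dimensional).

* `det_two_smul_fin_two` — `det (α·T₀ + β·T₁) = det T₀·α² + tr(adj T₀·T₁)·αβ + det T₁·β²` (any commutative ring);
* `eval_det_pencil_rankTwoNet_two` — the determinant of the pencil on letters `a_l·T₀ + b_l·T₁` evaluates to that binary quadratic at
  `(A(t), B(t))`, `A = ∑ a_l t^{d_l}`, `B = ∑ b_l t^{d_l}`;
* **`card_posRoots_le_of_rankTwoNet_two`** — for ANY `K`, ANY `d : Fin K → ℕ`, ANY real `2 × 2` matrices `T₀, T₁`: at most `2·(K − 1)`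
  distinct positive det-roots (every positive root is a root of `A − u·B` for a real root `u` of the quadratic `det(u·T₀ + T₁)` — at most
  two of them — or, when that quadratic has no real root, a common root of `A` and `B`; after a shear making `det T₀ ≠ 0`);
* `doorA26_ineq_on_rankTwoNet` — at `K = 6`: `≤ 10 ≤ 19`, `DoorA26`'s inequality with margin on the rank-`≤ 2` stratum of every support.

Nothing here bounds `ζ_sym(2,6)` beyond this stratum; `DoorA26`, `DoorA34` and `MatrixDescartes` (stmt-ValiantsHypothesis-18050) stay OPEN;
nothing bears on `VP ≠ VNP`.  [folklore] Binary quadratic forms have at most two real projective zeros + the sparse Descartes rule.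
-/

-- `Summit.ValiantsHypothesis.ValiantsHypothesis.…` repeats a component by the D-0017 layout
-- (single-conjunct summit), which the `dupNamespace` linter flags; the name is mandated.
set_option linter.dupNamespace false

namespace Summit.ValiantsHypothesis.ValiantsHypothesis.Theorems.LacunarySymmetroidMatrixDescartes.Census

open Polynomial Finset
open scoped BigOperators Polynomial Matrix
open Summit.ValiantsHypothesis.ValiantsHypothesis.Theorems.MatrixDescartes.Negative (PosRootLawAt)
open Summit.ValiantsHypothesis.ValiantsHypothesis.Theorems.SymmetroidDescartes (eval_det_pencil)

namespace RankTwoNet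

/-! ## The binary quadratic of a two-dimensional net of `2 × 2` matrices -/

/-- `2 × 2` expansion in two scalars over any commutative ring: `det (α·T₀ + β·T₁) = det T₀·α² + tr(adj T₀·T₁)·αβ + det T₁·β²`.
[folklore] -/
theorem det_two_smul_fin_two {R : Type*} [CommRing R] (T₀ T₁ : Matrix (Fin 2) (Fin 2) R) (α β : R) :
    (α • T₀ + β • T₁).det = T₀.det * α ^ 2 + (T₀.adjugate * T₁).trace * α * β + T₁.det * β ^ 2 := by
  simp only [Matrix.det_fin_two, Matrix.adjugate_fin_two, Matrix.trace_fin_two, Matrix.mul_apply, Fin.sum_univ_two,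
    Matrix.add_apply, Matrix.smul_apply, smul_eq_mul, Matrix.of_apply, Matrix.cons_val', Matrix.cons_val_zero,
    Matrix.cons_val_one, Matrix.empty_val', Matrix.cons_val_fin_one]
  ring

/-- The letters of a rank-two net of `2 × 2` matrices evaluate to `A(t)·T₀ + B(t)·T₁`. [folklore] -/
theorem sum_smul_rankTwoNet_two {K : ℕ} (d : Fin K → ℕ) (T₀ T₁ : Matrix (Fin 2) (Fin 2) ℝ) (a b : Fin K → ℝ) (t : ℝ) :
    (∑ l, t ^ d l • (a l • T₀ + b l • T₁)) = (∑ l, a l * t ^ d l) • T₀ + (∑ l, b l * t ^ d l) • T₁ := by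
  simp only [smul_add, smul_smul, Finset.sum_add_distrib, Finset.sum_smul]
  congr 1 <;> exact Finset.sum_congr rfl fun l _ => by rw [mul_comm]

/-- **Evaluation of the determinant of a rank-two net of `2 × 2` matrices.** [folklore] -/
theorem eval_det_pencil_rankTwoNet_two {K : ℕ} (d : Fin K → ℕ) (T₀ T₁ : Matrix (Fin 2) (Fin 2) ℝ) (a b : Fin K → ℝ) (t : ℝ) :
    ((∑ l, (X : ℝ[X]) ^ d l • (a l • T₀ + b l • T₁).map C).det).eval t
      = T₀.det * (∑ l, a l * t ^ d l) ^ 2 + (T₀.adjugate * T₁).trace * (∑ l, a l * t ^ d l) * (∑ l, b l * t ^ d l)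
        + T₁.det * (∑ l, b l * t ^ d l) ^ 2 := by
  rw [eval_det_pencil, sum_smul_rankTwoNet_two, det_two_smul_fin_two]

/-! ## The core count: `det T₀ ≠ 0` -/

/-- **Core count** (`det T₀ ≠ 0`, size `2`).  With `ψ(u) = det T₀·u² + tr(adj T₀·T₁)·u + det T₁`: if `ψ` has a real root, every positive
det-root `t` is a root of the `K`-nomial `A − u·B` for a real root `u` of `ψ` (`u = A(t)/B(t)` if `B(t) ≠ 0`; else `A(t) = 0` and any
root works) — at most `2·(K − 1)`; if `ψ` has no real root, every positive det-root is a common root of `A` and `B` — at most `K − 1`.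
[folklore] -/
theorem card_posRoots_le_of_rankTwoNet_two_of_det_ne_zero {K : ℕ} (d : Fin K → ℕ) (T₀ T₁ : Matrix (Fin 2) (Fin 2) ℝ)
    (a b : Fin K → ℝ) (h0 : T₀.det ≠ 0) :
    (((∑ l, (X : ℝ[X]) ^ d l • (a l • T₀ + b l • T₁).map C).det).roots.toFinset.filter (fun t => 0 < t)).card
      ≤ 2 * (K - 1) := by
  classical
  set P : ℝ[X] := (∑ l, (X : ℝ[X]) ^ d l • (a l • T₀ + b l • T₁).map C).det with hPdef
  by_cases hP : P = 0
  · rw [hP, Polynomial.roots_zero, Multiset.toFinset_zero, Finset.filter_empty, Finset.card_empty]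
    exact Nat.zero_le _
  set c₀ := T₀.det with hc₀
  set c₁ := (T₀.adjugate * T₁).trace with hc₁
  set c₂ := T₁.det with hc₂
  set A : ℝ[X] := ∑ l, C (a l) * (X : ℝ[X]) ^ d l with hA
  set B : ℝ[X] := ∑ l, C (b l) * (X : ℝ[X]) ^ d l with hB
  set ψ : ℝ[X] := C c₀ * X ^ 2 + C c₁ * X + C c₂ with hψ
  have hψeval : ∀ u : ℝ, ψ.eval u = c₀ * u ^ 2 + c₁ * u + c₂ := fun u => by
    simp only [hψ, eval_add, eval_mul, eval_C, eval_pow, eval_X]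
  have hψ0 : ψ ≠ 0 := by
    intro h
    have hc : ψ.coeff 2 = c₀ := by
      simp only [hψ, coeff_add, coeff_C_mul, coeff_X_pow, coeff_X, coeff_C]
      norm_num
    rw [h, coeff_zero] at hc
    exact h0 hc.symm
  set R : Finset ℝ := ψ.roots.toFinset with hR
  have hRcard : R.card ≤ 2 :=
    (Multiset.toFinset_card_le _).trans ((Polynomial.card_roots' ψ).trans (by
      rw [hψ]; exact Polynomial.natDegree_quadratic_le))
  have hRmem : ∀ u : ℝ, u ∈ R ↔ c₀ * u ^ 2 + c₁ * u + c₂ = 0 := fun u => by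
    rw [hR, Multiset.mem_toFinset, Polynomial.mem_roots hψ0, Polynomial.IsRoot.def, hψeval]
  have hevalP : ∀ t : ℝ, P.eval t = c₀ * (A.eval t) ^ 2 + c₁ * (A.eval t) * (B.eval t) + c₂ * (B.eval t) ^ 2 := fun t => by
    rw [hPdef, eval_det_pencil_rankTwoNet_two, hA, hB, eval_nodePoly, eval_nodePoly]
  -- the pieces `A − u·B` are non-zero
  have hpiece : ∀ u ∈ R, A - C u * B ≠ 0 := by
    intro u hu hzero
    have hu' := (hRmem u).mp hu
    apply hP
    apply eq_zero_of_forall_pos_isRoot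
    intro t _
    have hAB : A.eval t = u * B.eval t := by
      have := congrArg (fun p : ℝ[X] => p.eval t) hzero
      simp only [eval_sub, eval_mul, eval_C, eval_zero] at this
      linarith
    rw [Polynomial.IsRoot.def, hevalP t, hAB]
    have : c₀ * (u * B.eval t) ^ 2 + c₁ * (u * B.eval t) * B.eval t + c₂ * B.eval t ^ 2
        = (c₀ * u ^ 2 + c₁ * u + c₂) * B.eval t ^ 2 := by ring
    rw [this, hu', zero_mul]
  have hpiececard : ∀ u ∈ R, (((A - C u * B).roots.toFinset.filter (fun t => 0 < t))).card ≤ K - 1 := by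
    intro u hu
    have h := hpiece u hu
    rw [hA, hB, nomial_sub_smul] at h ⊢
    exact card_posRoots_borderNomial_le d _ h
  -- at a positive det-root with `B(t) = 0`, also `A(t) = 0`
  have hAzero : ∀ t : ℝ, P.eval t = 0 → B.eval t = 0 → A.eval t = 0 := by
    intro t hroot hβ
    rw [hevalP, hβ] at hroot
    have hα2 : c₀ * (A.eval t) ^ 2 = 0 := by linarith [hroot]
    rcases mul_eq_zero.mp hα2 with h | h
    · exact absurd h h0
    · exact pow_eq_zero_iff (by norm_num) |>.mp h
  by_cases hRne : R.Nonempty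
  · -- cover by the pieces
    have hcover : (P.roots.toFinset.filter (fun t => 0 < t))
        ⊆ R.biUnion (fun u => ((A - C u * B).roots.toFinset.filter (fun t => 0 < t))) := by
      intro t ht
      rw [Finset.mem_filter, Multiset.mem_toFinset, Polynomial.mem_roots hP, Polynomial.IsRoot.def] at ht
      obtain ⟨hroot, hpos⟩ := ht
      rw [Finset.mem_biUnion]
      by_cases hβ : B.eval t = 0
      · have hα := hAzero t hroot hβ
        obtain ⟨u, hu⟩ := hRne
        refine ⟨u, hu, ?_⟩
        rw [Finset.mem_filter, Multiset.mem_toFinset, Polynomial.mem_roots (hpiece u hu), Polynomial.IsRoot.def,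
          eval_sub, eval_mul, eval_C, hα, hβ]
        exact ⟨by ring, hpos⟩
      · set u := A.eval t / B.eval t with hu
        have huR : u ∈ R := by
          rw [hRmem]
          have hAu : A.eval t = u * B.eval t := by rw [hu]; field_simp
          rw [hevalP, hAu] at hroot
          have : (c₀ * u ^ 2 + c₁ * u + c₂) * (B.eval t) ^ 2 = 0 := by linear_combination hroot
          rcases mul_eq_zero.mp this with h | h
          · exact h
          · exact absurd (pow_eq_zero_iff (by norm_num) |>.mp h) hβ
        refine ⟨u, huR, ?_⟩
        rw [Finset.mem_filter, Multiset.mem_toFinset, Polynomial.mem_roots (hpiece u huR), Polynomial.IsRoot.def,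
          eval_sub, eval_mul, eval_C, hu]
        exact ⟨by rw [div_mul_cancel₀ _ hβ, sub_self], hpos⟩
    calc (P.roots.toFinset.filter (fun t => 0 < t)).card
        ≤ (R.biUnion (fun u => ((A - C u * B).roots.toFinset.filter (fun t => 0 < t)))).card :=
          Finset.card_le_card hcover
      _ ≤ ∑ u ∈ R, (((A - C u * B).roots.toFinset.filter (fun t => 0 < t))).card := Finset.card_biUnion_le
      _ ≤ R.card * (K - 1) := by
          have := Finset.sum_le_card_nsmul R _ (K - 1) hpiececard
          simpa using this
      _ ≤ 2 * (K - 1) := Nat.mul_le_mul_right _ hRcard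
  · -- no real root of `ψ`: every positive det-root is a common root of `A` and `B`
    rw [Finset.not_nonempty_iff_eq_empty] at hRne
    have hAB : ∀ t : ℝ, P.eval t = 0 → A.eval t = 0 ∧ B.eval t = 0 := by
      intro t hroot
      by_cases hβ : B.eval t = 0
      · exact ⟨hAzero t hroot hβ, hβ⟩
      · exfalso
        set u := A.eval t / B.eval t with hu
        have huR : u ∈ R := by
          rw [hRmem]
          have hAu : A.eval t = u * B.eval t := by rw [hu]; field_simp
          rw [hevalP, hAu] at hroot
          have : (c₀ * u ^ 2 + c₁ * u + c₂) * (B.eval t) ^ 2 = 0 := by linear_combination hroot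
          rcases mul_eq_zero.mp this with h | h
          · exact h
          · exact absurd (pow_eq_zero_iff (by norm_num) |>.mp h) hβ
        rw [hRne] at huR
        exact Finset.notMem_empty u huR
    -- `A` or `B` is a non-zero `K`-nomial (else `P = 0`)
    by_cases hA0 : A = 0
    · by_cases hB0 : B = 0
      · exfalso
        apply hP
        apply eq_zero_of_forall_pos_isRoot
        intro t _
        rw [Polynomial.IsRoot.def, hevalP t, hA0, hB0, eval_zero]
        ring
      · have hcover : (P.roots.toFinset.filter (fun t => 0 < t)) ⊆ (B.roots.toFinset.filter (fun t => 0 < t)) := by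
          intro t ht
          rw [Finset.mem_filter, Multiset.mem_toFinset, Polynomial.mem_roots hP, Polynomial.IsRoot.def] at ht
          rw [Finset.mem_filter, Multiset.mem_toFinset, Polynomial.mem_roots hB0, Polynomial.IsRoot.def]
          exact ⟨(hAB t ht.1).2, ht.2⟩
        have hBcard : (B.roots.toFinset.filter (fun t => 0 < t)).card ≤ K - 1 := by
          rw [hB] at hB0 ⊢
          exact card_posRoots_borderNomial_le d b hB0
        calc (P.roots.toFinset.filter (fun t => 0 < t)).card ≤ (B.roots.toFinset.filter (fun t => 0 < t)).card :=
              Finset.card_le_card hcover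
          _ ≤ K - 1 := hBcard
          _ ≤ 2 * (K - 1) := by omega
    · have hcover : (P.roots.toFinset.filter (fun t => 0 < t)) ⊆ (A.roots.toFinset.filter (fun t => 0 < t)) := by
        intro t ht
        rw [Finset.mem_filter, Multiset.mem_toFinset, Polynomial.mem_roots hP, Polynomial.IsRoot.def] at ht
        rw [Finset.mem_filter, Multiset.mem_toFinset, Polynomial.mem_roots hA0, Polynomial.IsRoot.def]
        exact ⟨(hAB t ht.1).1, ht.2⟩
      have hAcard : (A.roots.toFinset.filter (fun t => 0 < t)).card ≤ K - 1 := by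
        rw [hA] at hA0 ⊢
        exact card_posRoots_borderNomial_le d a hA0
      calc (P.roots.toFinset.filter (fun t => 0 < t)).card ≤ (A.roots.toFinset.filter (fun t => 0 < t)).card :=
            Finset.card_le_card hcover
        _ ≤ K - 1 := hAcard
        _ ≤ 2 * (K - 1) := by omega

/-! ## The shear to `det T₀ ≠ 0`, and the count for every rank-two net of `2 × 2` matrices -/

/-- **THE RANK-TWO NET COUNT AT SIZE `2` (every `K`, every support, any real `2 × 2` matrices).**  If the letters of the pencil
`∑ₗ X^{d_l} S_l` lie in the span of two `2 × 2` matrices, `S_l = a_l·T₀ + b_l·T₁`, its determinant has at most `2·(K − 1)` distinct positive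
roots. [folklore] -/
theorem card_posRoots_le_of_rankTwoNet_two {K : ℕ} (d : Fin K → ℕ) (T₀ T₁ : Matrix (Fin 2) (Fin 2) ℝ) (a b : Fin K → ℝ) :
    (((∑ l, (X : ℝ[X]) ^ d l • (a l • T₀ + b l • T₁).map C).det).roots.toFinset.filter (fun t => 0 < t)).card
      ≤ 2 * (K - 1) := by
  classical
  set c₀ := T₀.det with hc₀
  set c₁ := (T₀.adjugate * T₁).trace with hc₁
  set c₂ := T₁.det with hc₂
  set q : ℝ[X] := C (0 : ℝ) * X ^ 3 + C c₂ * X ^ 2 + C c₁ * X + C c₀ with hq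
  have hqeval : ∀ μ : ℝ, q.eval μ = (T₀ + μ • T₁).det := fun μ => by
    have h := det_two_smul_fin_two T₀ T₁ (1 : ℝ) μ
    rw [one_smul] at h
    rw [h]
    simp only [hq, eval_add, eval_mul, eval_C, eval_pow, eval_X]
    ring
  by_cases hq0 : q = 0
  · have hcoef : c₀ = 0 ∧ c₁ = 0 ∧ c₂ = 0 := by
      have e0 : q.coeff 0 = c₀ := by
        simp only [hq, coeff_add, coeff_C_mul, coeff_X_pow, coeff_X, coeff_C]; norm_num
      have e1 : q.coeff 1 = c₁ := by
        simp only [hq, coeff_add, coeff_C_mul, coeff_X_pow, coeff_X, coeff_C]; norm_num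
      have e2 : q.coeff 2 = c₂ := by
        simp only [hq, coeff_add, coeff_C_mul, coeff_X_pow, coeff_X, coeff_C]; norm_num
      rw [hq0, coeff_zero] at e0 e1 e2
      exact ⟨e0.symm, e1.symm, e2.symm⟩
    have hP : (∑ l, (X : ℝ[X]) ^ d l • (a l • T₀ + b l • T₁).map C).det = 0 := by
      apply eq_zero_of_forall_pos_isRoot
      intro t _
      rw [Polynomial.IsRoot.def, eval_det_pencil_rankTwoNet_two, ← hc₀, ← hc₁, ← hc₂, hcoef.1, hcoef.2.1, hcoef.2.2]
      ring
    rw [hP, Polynomial.roots_zero, Multiset.toFinset_zero, Finset.filter_empty, Finset.card_empty]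
    exact Nat.zero_le _
  · obtain ⟨μ, hμ⟩ := exists_nonroot_of_cubic q hq0 (by rw [hq]; exact Polynomial.natDegree_cubic_le)
    rw [hqeval] at hμ
    have key := card_posRoots_le_of_rankTwoNet_two_of_det_ne_zero d (T₀ + μ • T₁) T₁ a (fun l => b l - μ * a l) hμ
    have hsum : (∑ l, (X : ℝ[X]) ^ d l • (a l • T₀ + b l • T₁).map C)
        = ∑ l, (X : ℝ[X]) ^ d l • (a l • (T₀ + μ • T₁) + (b l - μ * a l) • T₁).map C :=
      Finset.sum_congr rfl fun l _ => by
        rw [show a l • T₀ + b l • T₁ = a l • (T₀ + μ • T₁) + (b l - μ * a l) • T₁ by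
          rw [smul_add, smul_smul, sub_smul, mul_comm μ (a l)]; abel]
    rw [hsum]
    exact key

/-! ## Door A at `(2,6)` on the rank-two stratum -/

/-- **`DoorA26`'s inequality with margin on the RANK-TWO NET stratum (all supports).**  A six-letter `2 × 2` pencil (letters not even
required symmetric) whose letters span a space of matrices of dimension `≤ 2` has at most `10` distinct positive det-roots. [folklore] -/
theorem card_posRoots_le_ten_of_rankTwoNet (d : Fin 6 → ℕ) (S : Fin 6 → Matrix (Fin 2) (Fin 2) ℝ)
    (T₀ T₁ : Matrix (Fin 2) (Fin 2) ℝ) (a b : Fin 6 → ℝ) (hS : ∀ l, S l = a l • T₀ + b l • T₁) :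
    (((∑ l, (X : ℝ[X]) ^ d l • (S l).map C).det).roots.toFinset.filter (fun t => 0 < t)).card ≤ 10 := by
  have h := card_posRoots_le_of_rankTwoNet_two d T₀ T₁ a b
  have hsum : (∑ l, (X : ℝ[X]) ^ d l • (S l).map C) = ∑ l, (X : ℝ[X]) ^ d l • (a l • T₀ + b l • T₁).map C :=
    Finset.sum_congr rfl fun l _ => by rw [hS l]
  rw [hsum]
  exact h.trans (by norm_num)

/-- Hence the door's `≤ 19` on that stratum, for every support `d`. [folklore] -/
theorem doorA26_ineq_on_rankTwoNet (d : Fin 6 → ℕ) (S : Fin 6 → Matrix (Fin 2) (Fin 2) ℝ)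
    (T₀ T₁ : Matrix (Fin 2) (Fin 2) ℝ) (a b : Fin 6 → ℝ) (hS : ∀ l, S l = a l • T₀ + b l • T₁) :
    (((∑ l, (X : ℝ[X]) ^ d l • (S l).map C).det).roots.toFinset.filter (fun t => 0 < t)).card ≤ 19 :=
  (card_posRoots_le_ten_of_rankTwoNet d S T₀ T₁ a b hS).trans (by norm_num)

end RankTwoNet

end Summit.ValiantsHypothesis.ValiantsHypothesis.Theorems.LacunarySymmetroidMatrixDescartes.Census
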